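import Mathlib.Analysis.Normed.Module.WeakDual
import Mathlib.Analysis.InnerProductSpace.Dual
import Mathlib.MeasureTheory.Measure.SeparableMeasure
import Mathlib.MeasureTheory.Measure.Haar.NormedSpace
import Literature.Analysis.FluidPDE.RusinSverakCompactness
import HarnessLib

/-!
# Rusin–Šverák compactness of minimal blow-up data: proof architecture
(companion of `Literature/Analysis/FluidPDE/RusinSverakCompactness.lean`, named fact
`Literature.Analysis.FluidPDE.rusin_sverak_minimal_data_compact` = Rusin–Šverák, arXiv:0911.0500, Cor. 4.3 (p. 8),
second clause; J. Funct. Anal. 260 (2011) 879–891)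

The printed proof of Cor. 4.3 (arXiv p. 8) has five steps. For a sequence `u₀^k ∈ M`
(`‖u₀^k‖_{Ḣ^{1/2}} = ρ_max`, `T_max(u₀^k) < ∞`):

1. *Normalisation.* Choose `λ_k > 0`, `x₀^k ∈ ℝ³` such that `v^k(x,t) = λ_k u^k(λ_k x - x₀^k, λ_k² t)`
   develops its first singularity at `t = 1` and `(0,1)` is a singular point (this uses §3, p. 5:
   `T_max < ∞` forces blow-up of the `L⁴_t Ḣ¹_x` norm; §4, p. 6: the only reason for
   `T_max < ∞` is a singularity of the Leray solution; Prop. 4.1, p. 7: the singular set is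
   compact).
2. *Weak compactness.* `‖v₀^k‖_{Ḣ^{1/2}} = ρ_max` (the norm is invariant under the symmetries,
   §1 p. 3), so a subsequence converges weakly in the Hilbert space `Ḣ^{1/2}` to some `v₀`.
3. *Stability of singularities* (Cor. 4.2, p. 8, resting on Thm. 4.2, Lemma 4.1, Prop. 2.2,
   Lemma 2.1 and Thm. 4.1): `T_max(v₀) ≤ 1`.
4. *Minimality.* By the definition of `ρ_max`, `‖v₀‖ ≥ ρ_max`; by weak lower semicontinuity
   `‖v₀‖ ≤ ρ_max`; hence `‖v₀^k‖ → ‖v₀‖`.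
5. *Radon–Riesz.* Weak convergence plus convergence of norms in a Hilbert space is strong
   convergence, so `{v₀^k}` is relatively compact.

Steps 2, 4, 5 are functional analysis in the Hilbert space `Ḣ^{1/2}` plus the unfolding of
`rusinSverakRhoMaxPure` (`hasGlobalKatoSolution_of_lt_rusinSverakRhoMaxPure`); they are **proved**
below: `exists_strictMono_tendsto_inner` (sequential Banach–Alaoglu + Riesz in a separable
Hilbert space), `tendsto_of_tendsto_inner_of_norm_eq` (Radon–Riesz),
`isCompact_closure_range_of_subseq`, the invariance of `Ḣ^{1/2}` and of the representation
predicate `HomSobolev.Represents` under the symmetries `u₀ ↦ λ u₀(λ · - x₀)` (§1 p. 3;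
`NS.exists_represents_rescaleData_norm_eq`, Fourier side `ĝ'(ξ) = λ⁻² e^{-2πi⟨x₀,ξ⟩/λ} ĝ(ξ/λ)`,
proved from Mathlib's change of variables and Fourier inversion on `𝓢`), and the assembly
`NS.rusin_sverak_minimal_data_compact_of_weak_limit_blowup`. Steps 1 and 3 are the PDE content
of the paper (CKN ε-regularity, Lemarié-Rieusset's local energy estimates, weak–strong
uniqueness, weak stability of Leray solutions); they are recorded, on the level of data, as the
single named fact `NS.rusin_sverak_weak_limit_blowup` (to be refined into Cor. 4.2 and the
normalisation lemma once `T_max` of Kato solutions and Rusin–Šverák's Leray solutions for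
`Ḣ^{1/2}` data are Literature notions).

Main result of this file:
`NS.rusin_sverak_minimal_data_compact_of_weak_limit_blowup :
  NS.rusin_sverak_weak_limit_blowup → NS.rusin_sverak_minimal_data_compact`.

Weak convergence in the complex Hilbert space `H = Ḣ^{1/2}` is written
`∀ w, ⟪x_n, w⟫ → ⟪x, w⟫` (Mathlib's inner product is conjugate-linear in the first slot; by
conjugation this is `f(x_n) → f(x)` for every `f = ⟪w, ·⟫ ∈ H*`, i.e. weak convergence, Riesz).

## References

* W. Rusin, V. Šverák, *Minimal initial data for potential Navier–Stokes singularities*,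
  J. Funct. Anal. 260 (2011) 879–891; arXiv:0911.0500: §1 p. 3, §3 p. 5, §4 pp. 6–8
  (Thm. 4.1, Prop. 4.1, Lemma 4.1, Thm. 4.2, Cor. 4.2, Cor. 4.3).
* I. Gallagher, G. S. Koch, F. Planchon, Math. Ann. 355 (2013) 1527–1559; arXiv:1012.0145,
  Thm. 9 (second printed source of the compactness statement).
* H. Bahouri, J.-Y. Chemin, R. Danchin, *Fourier Analysis and Nonlinear PDE* (2011), Def. 1.31,
  Prop. 1.34 (the Hilbert space `Ḣ^s`, `s < d/2`).
-/

noncomputable section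

open MeasureTheory TopologicalSpace Filter Topology Set Function FourierTransform
open scoped ENNReal InnerProductSpace RealInnerProductSpace SchwartzMap

namespace Literature.Analysis.FluidPDE

local notation "ℝ³" => EuclideanSpace ℝ (Fin 3)
local notation "ℂ³" => EuclideanSpace ℂ (Fin 3)

/-! ## Functional analysis in Hilbert spaces -/

/-- `Ḣ^{1/2}(ℝ³; ℂ³)` (Fourier-side realisation `L²(‖ξ‖ dξ; ℂ³)`) is second countable, hence
separable: Mathlib's `Lp.SecondCountableTopology` for the `s`-finite measure `‖ξ‖ dξ` on the
countably generated space `ℝ³` (cf. Bahouri–Chemin–Danchin 2011, Prop. 1.34 for the Hilbert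
space `Ḣ^s`, `s < d/2`). [folklore] -/
theorem homSobolev_half_secondCountableTopology :
    SecondCountableTopology (FunctionSpaces.HomSobolev ℝ³ ℂ³ (1 / 2 : ℝ)) := by
  haveI : Fact ((2 : ℝ≥0∞) ≠ ⊤) := ⟨ENNReal.ofNat_ne_top⟩
  haveI : SFinite (FunctionSpaces.homSobolevMeasure ℝ³ (1 / 2 : ℝ)) := by
    unfold FunctionSpaces.homSobolevMeasure; infer_instance
  change SecondCountableTopology (Lp ℂ³ 2 (FunctionSpaces.homSobolevMeasure ℝ³ (1 / 2 : ℝ)))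
  infer_instance

/-- **Weak sequential compactness of bounded sequences in a separable Hilbert space**: if
`‖x n‖ ≤ R` for all `n`, a subsequence converges weakly to some `a` with `‖a‖ ≤ R`, i.e.
`⟪x (φ n), w⟫ → ⟪a, w⟫` for every `w`. Proof: sequential Banach–Alaoglu in the weak-* dual
(Mathlib `WeakDual.isSeqCompact_closedBall`) transported by the Riesz isometry
`InnerProductSpace.toDual`. [folklore] -/
theorem exists_strictMono_tendsto_inner {H : Type*} [NormedAddCommGroup H]
    [InnerProductSpace ℂ H] [CompleteSpace H] [SeparableSpace H] (x : ℕ → H) {R : ℝ}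
    (hx : ∀ n, ‖x n‖ ≤ R) :
    ∃ (a : H) (φ : ℕ → ℕ), StrictMono φ ∧ ‖a‖ ≤ R ∧
      ∀ w : H, Tendsto (fun n => ⟪x (φ n), w⟫_ℂ) atTop (𝓝 ⟪a, w⟫_ℂ) := by
  set ψ : ℕ → WeakDual ℂ H :=
    fun n => StrongDual.toWeakDual (InnerProductSpace.toDual ℂ H (x n)) with hψ
  have hmem : ∀ n, ψ n ∈ WeakDual.toStrongDual ⁻¹' Metric.closedBall (0 : StrongDual ℂ H) R := by
    intro n
    simp only [Set.mem_preimage, Metric.mem_closedBall, dist_zero_right, hψ,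
      StrongDual.toStrongDual_toWeakDual, LinearIsometryEquiv.norm_map]
    exact hx n
  obtain ⟨ℓ, hℓ, φ, hφ, hlim⟩ := (WeakDual.isSeqCompact_closedBall ℂ H 0 R) hmem
  refine ⟨(InnerProductSpace.toDual ℂ H).symm (WeakDual.toStrongDual ℓ), φ, hφ, ?_, ?_⟩
  · simp only [Set.mem_preimage, Metric.mem_closedBall, dist_zero_right] at hℓ
    simpa using hℓ
  · intro w
    rw [tendsto_iff_forall_eval_tendsto_topDualPairing] at hlim
    have h := hlim w
    simp only [topDualPairing_apply, comp_apply, hψ, StrongDual.toWeakDual] at h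
    rw [InnerProductSpace.toDual_symm_apply]
    exact h

/-- **Radon–Riesz property of Hilbert spaces** (the case of constant norms): if `x n → a`
weakly (`⟪x n, w⟫ → ⟪a, w⟫` for all `w`) and `‖x n‖ = ‖a‖` for all `n`, then `x n → a` in
norm, since `‖x n - a‖² = ‖x n‖² - 2 Re ⟪x n, a⟫ + ‖a‖² → 0`. [folklore] -/
theorem tendsto_of_tendsto_inner_of_norm_eq {H : Type*} [NormedAddCommGroup H]
    [InnerProductSpace ℂ H] {x : ℕ → H} {a : H}
    (hw : ∀ w : H, Tendsto (fun n => ⟪x n, w⟫_ℂ) atTop (𝓝 ⟪a, w⟫_ℂ))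
    (hn : ∀ n, ‖x n‖ = ‖a‖) : Tendsto x atTop (𝓝 a) := by
  have hre : Tendsto (fun n => RCLike.re ⟪x n, a⟫_ℂ) atTop (𝓝 (‖a‖ ^ 2)) := by
    have h1 : Tendsto (fun n => RCLike.re ⟪x n, a⟫_ℂ) atTop (𝓝 (RCLike.re ⟪a, a⟫_ℂ)) :=
      (RCLike.continuous_re.tendsto _).comp (hw a)
    have h2 : RCLike.re ⟪a, a⟫_ℂ = ‖a‖ ^ 2 := by
      rw [inner_self_eq_norm_sq_to_K]; norm_cast
    rwa [h2] at h1
  have hsq : Tendsto (fun n => ‖x n - a‖ ^ 2) atTop (𝓝 0) := by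
    have h2 : ∀ n, ‖x n - a‖ ^ 2 = 2 * ‖a‖ ^ 2 - 2 * RCLike.re ⟪x n, a⟫_ℂ := by
      intro n
      rw [@norm_sub_sq ℂ, hn n]; ring
    simp_rw [h2]
    have : Tendsto (fun n => 2 * ‖a‖ ^ 2 - 2 * RCLike.re ⟪x n, a⟫_ℂ) atTop
        (𝓝 (2 * ‖a‖ ^ 2 - 2 * ‖a‖ ^ 2)) := (hre.const_mul 2).const_sub _
    simpa using this
  rw [tendsto_iff_norm_sub_tendsto_zero]
  have h := hsq.sqrt
  simpa [Real.sqrt_sq (norm_nonneg _)] using h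

/-- From any index map `k : ℕ → ℕ` one can extract, along a strictly increasing `φ`, either a
constant or a strictly increasing subsequence `k ∘ φ` (pigeonhole if `k` does not tend to
infinity, `strictMono_subseq_of_tendsto_atTop` otherwise). [folklore] -/
theorem exists_strictMono_const_or_strictMono (k : ℕ → ℕ) :
    ∃ φ : ℕ → ℕ, StrictMono φ ∧ ((∃ c, ∀ n, k (φ n) = c) ∨ StrictMono (k ∘ φ)) := by
  by_cases h : Tendsto k atTop atTop
  · obtain ⟨φ, hφ, hkφ⟩ := strictMono_subseq_of_tendsto_atTop h
    exact ⟨φ, hφ, Or.inr hkφ⟩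
  · rw [tendsto_atTop_atTop] at h
    push Not at h
    obtain ⟨b, hb⟩ := h
    have hfreq : ∃ᶠ n in atTop, k n < b := by
      rw [frequently_atTop]
      intro a
      obtain ⟨n, hn, hlt⟩ := hb a
      exact ⟨n, hn, hlt⟩
    have hc : ∃ c, ∃ᶠ n in atTop, k n = c := by
      by_contra hcon
      push Not at hcon
      have hall : ∀ᶠ n in atTop, ∀ i : Fin b, k n ≠ i := by
        rw [eventually_all]
        intro i
        exact (hcon i)
      obtain ⟨n, hn1, hn2⟩ := (hfreq.and_eventually hall).exists
      exact hn2 ⟨k n, hn1⟩ rfl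
    obtain ⟨c, hc⟩ := hc
    obtain ⟨φ, hφ, hkφ⟩ := extraction_of_frequently_atTop hc
    exact ⟨φ, hφ, Or.inl ⟨c, hkφ⟩⟩

/-- **Relative compactness from the subsequence principle**: in a (pseudo)metric space, if every
subsequence `x ∘ σ` of a sequence has a further convergent subsequence, then the range of `x`
has compact closure (sequences in the closure are shadowed by sequences in the range; compact =
sequentially compact in metric spaces, Mathlib `isCompact_iff_isSeqCompact`). [folklore] -/
theorem isCompact_closure_range_of_subseq {X : Type*} [PseudoMetricSpace X] (x : ℕ → X)
    (h : ∀ σ : ℕ → ℕ, StrictMono σ →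
      ∃ (a : X) (φ : ℕ → ℕ), StrictMono φ ∧ Tendsto (fun n => x (σ (φ n))) atTop (𝓝 a)) :
    IsCompact (closure (range x)) := by
  rw [isCompact_iff_isSeqCompact]
  intro y hy
  have hk : ∀ n, ∃ k : ℕ, dist (y n) (x k) < 1 / ((n : ℝ) + 1) := by
    intro n
    obtain ⟨b, ⟨k, rfl⟩, hb⟩ := Metric.mem_closure_iff.1 (hy n) (1 / ((n : ℝ) + 1))
      Nat.one_div_pos_of_nat
    exact ⟨k, hb⟩
  choose k hk using hk
  have hdist : ∀ (ψ : ℕ → ℕ), StrictMono ψ →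
      Tendsto (fun n => dist (y (ψ n)) (x (k (ψ n)))) atTop (𝓝 0) := by
    intro ψ hψ
    have h0 : Tendsto (fun n : ℕ => 1 / ((n : ℝ) + 1)) atTop (𝓝 0) :=
      tendsto_one_div_add_atTop_nhds_zero_nat
    have h1 : Tendsto (fun n : ℕ => 1 / (((ψ n : ℕ) : ℝ) + 1)) atTop (𝓝 0) :=
      h0.comp hψ.tendsto_atTop
    exact squeeze_zero (fun n => dist_nonneg) (fun n => (hk (ψ n)).le) h1
  obtain ⟨φ₁, hφ₁, hcase⟩ := exists_strictMono_const_or_strictMono k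
  rcases hcase with ⟨c, hc⟩ | hmono
  · refine ⟨x c, subset_closure ⟨c, rfl⟩, φ₁, hφ₁, ?_⟩
    rw [tendsto_iff_dist_tendsto_zero]
    have := hdist φ₁ hφ₁
    simpa [hc] using this
  · obtain ⟨a, φ₂, hφ₂, ha⟩ := h (k ∘ φ₁) hmono
    refine ⟨a, ?_, φ₁ ∘ φ₂, hφ₁.comp hφ₂, ?_⟩
    · exact mem_closure_of_tendsto ha (Eventually.of_forall fun n => ⟨_, rfl⟩)
    · have hd := hdist (φ₁ ∘ φ₂) (hφ₁.comp hφ₂)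
      rw [tendsto_iff_dist_tendsto_zero]
      have ha' : Tendsto (fun n => dist (x (k (φ₁ (φ₂ n)))) a) atTop (𝓝 0) := by
        rw [tendsto_iff_dist_tendsto_zero] at ha
        exact ha
      refine squeeze_zero (fun n => dist_nonneg)
        (fun n => dist_triangle (y ((φ₁ ∘ φ₂) n)) (x (k (φ₁ (φ₂ n)))) a) ?_
      simpa using hd.add ha'

/-! ## Invariance of `Ḣ^{1/2}(ℝ³)` and of `HomSobolev.Represents` under the symmetries

For `λ > 0`, `x₀ ∈ ℝ³` and a datum `f` represented (in the sense of `HomSobolev.Represents`) by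
the Fourier-side class `g ∈ L²(‖ξ‖ dξ; ℂ³)`, the modulated datum `x ↦ λ f(λ x - x₀)` is
represented by `g'(ξ) = λ⁻² e^{-2πi⟨x₀, ξ⟩/λ} g(ξ/λ)`, and `‖g'‖ = ‖g‖` (Rusin–Šverák 2011, §1,
p. 3: the `Ḣ^{1/2}` norm is invariant under `u₀ ↦ λ u₀(λ ·)` and under translations). The
pairing identity `∫ 𝓕φ • f' = ∫ φ • g'` is reduced to the one for `(f, g)` through the Schwartz
function `ψ = 𝓕⁻¹((𝓕φ)(λ⁻¹(· + x₀))) = λ³ e^{-2πi⟨x₀, ·⟩} φ(λ ·)`. -/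

namespace HomSobolevSymmetry

/-- The weight of `Ḣ^{1/2}(ℝ³)` is `‖ξ‖^{2 · 1/2} = ‖ξ‖` (Bahouri–Chemin–Danchin 2011,
Def. 1.31). [cite: BahouriCheminDanchin2011, Def. 1.31] -/
theorem homSobolevMeasure_half_eq :
    FunctionSpaces.homSobolevMeasure ℝ³ (1 / 2 : ℝ) = (volume : Measure ℝ³).withDensity fun ξ => ‖ξ‖ₑ := by
  rw [FunctionSpaces.homSobolevMeasure]
  congr 1
  funext ξ
  norm_num

/-- Lebesgue measure is absolutely continuous w.r.t. `‖ξ‖ dξ` (the weight vanishes only at the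
origin). [folklore] -/
theorem volume_absolutelyContinuous_homSobolevMeasure_half :
    (volume : Measure ℝ³) ≪ FunctionSpaces.homSobolevMeasure ℝ³ (1 / 2 : ℝ) := by
  rw [homSobolevMeasure_half_eq]
  refine withDensity_absolutelyContinuous' (by fun_prop) ?_
  have : ∀ᵐ ξ ∂(volume : Measure ℝ³), ξ ≠ 0 := by
    rw [ae_iff]; simp [measure_singleton]
  filter_upwards [this] with ξ hξ
  simpa using hξ

/-- `‖ξ‖ dξ` is absolutely continuous w.r.t. Lebesgue measure (Mathlib
`withDensity_absolutelyContinuous`). [folklore] -/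
theorem homSobolevMeasure_half_absolutelyContinuous_volume :
    FunctionSpaces.homSobolevMeasure ℝ³ (1 / 2 : ℝ) ≪ (volume : Measure ℝ³) := by
  rw [FunctionSpaces.homSobolevMeasure]
  exact withDensity_absolutelyContinuous _ _

/-- Change of variables `x ↦ c x` (`c > 0`) in a Lebesgue integral over `ℝ³`:
`∫⁻ f(c x) dx = c⁻³ ∫⁻ f` (Mathlib `Measure.map_addHaar_smul`). [folklore] -/
theorem lintegral_comp_smul (f : ℝ³ → ℝ≥0∞) {c : ℝ} (hc : 0 < c) :
    ∫⁻ x, f (c • x) = ENNReal.ofReal ((c ^ 3)⁻¹) * ∫⁻ x, f x := by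
  have hc0 : c ≠ 0 := hc.ne'
  let e : ℝ³ ≃ᵐ ℝ³ := (Homeomorph.smul (isUnit_iff_ne_zero.2 hc0).unit).toMeasurableEquiv
  have he : (e : ℝ³ → ℝ³) = fun x => c • x := rfl
  calc ∫⁻ x, f (c • x) = ∫⁻ y, f y ∂(Measure.map (fun x => c • x) volume) := by
        rw [← he, lintegral_map_equiv]; rfl
    _ = ENNReal.ofReal ((c ^ 3)⁻¹) * ∫⁻ x, f x := by
        rw [Measure.map_addHaar_smul volume hc0, lintegral_smul_measure,
          finrank_euclideanSpace_fin, abs_of_nonneg (by positivity)]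
        rfl

/-- Dilations `ξ ↦ c ξ` (`c ≠ 0`) are quasi-measure-preserving for `‖ξ‖ dξ` (they map it to a
multiple of itself). [folklore] -/
theorem quasiMeasurePreserving_smul {c : ℝ} (hc : c ≠ 0) :
    Measure.QuasiMeasurePreserving (fun ξ : ℝ³ => c • ξ)
      (FunctionSpaces.homSobolevMeasure ℝ³ (1 / 2 : ℝ)) (FunctionSpaces.homSobolevMeasure ℝ³ (1 / 2 : ℝ)) := by
  refine ⟨by fun_prop, ?_⟩
  have h1 : Measure.map (fun ξ : ℝ³ => c • ξ) (FunctionSpaces.homSobolevMeasure ℝ³ (1 / 2 : ℝ)) ≪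
      Measure.map (fun ξ : ℝ³ => c • ξ) volume :=
    homSobolevMeasure_half_absolutelyContinuous_volume.map (by fun_prop)
  have h2 : Measure.map (fun ξ : ℝ³ => c • ξ) (volume : Measure ℝ³) ≪ volume := by
    rw [Measure.map_addHaar_smul _ hc]
    exact Measure.AbsolutelyContinuous.rfl.smul_left _
  exact (h1.trans h2).trans volume_absolutelyContinuous_homSobolevMeasure_half

/-- The modulation character `χ_{x₀}(η) = e^{-2πi⟨x₀, η⟩}`, written as a complex exponential
(equal to Mathlib's `𝐞 (-⟪x₀, η⟫)`, see `modChar_eq`). [folklore] -/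
def modChar (x₀ : ℝ³) (η : ℝ³) : ℂ := Complex.exp (↑(2 * Real.pi * -⟪x₀, η⟫) * Complex.I)

/-- `modChar x₀ η = 𝐞 (-⟪x₀, η⟫)` (Mathlib's Fourier character). [folklore] -/
theorem modChar_eq (x₀ η : ℝ³) : modChar x₀ η = (𝐞 (-⟪x₀, η⟫) : ℂ) := rfl

/-- The modulation character is unimodular. [folklore] -/
theorem norm_modChar (x₀ η : ℝ³) : ‖modChar x₀ η‖ = 1 := Complex.norm_exp_ofReal_mul_I _

/-- The modulation character is continuous. [folklore] -/
theorem continuous_modChar (x₀ : ℝ³) : Continuous (modChar x₀) := by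
  unfold modChar
  fun_prop

/-- The undilated kernel `K(η) = λ⁻² χ_{x₀}(η) g₀(η)` of the Fourier-side symmetry action.
[folklore] -/
def modKer (lam : ℝ) (x₀ : ℝ³) (g₀ : ℝ³ → ℂ³) (η : ℝ³) : ℂ³ :=
  ((lam ^ 2)⁻¹ : ℝ) • (modChar x₀ η • g₀ η)

/-- The Fourier-side action of the symmetry `u₀ ↦ λ u₀(λ · - x₀)` on a representative `g₀` of
an `Ḣ^{1/2}` class: `g'(ξ) = λ⁻² e^{-2πi⟨x₀, ξ⟩/λ} g₀(ξ/λ)` (Rusin–Šverák 2011, §1 p. 3, on the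
Fourier side). [cite: RusinSverak2011, §1 (arXiv:0911.0500 p. 3)] -/
def modFun (lam : ℝ) (x₀ : ℝ³) (g₀ : ℝ³ → ℂ³) (ξ : ℝ³) : ℂ³ :=
  modKer lam x₀ g₀ (lam⁻¹ • ξ)

/-- Unfolding `modFun`. [folklore] -/
theorem modFun_apply (lam : ℝ) (x₀ : ℝ³) (g₀ : ℝ³ → ℂ³) (ξ : ℝ³) :
    modFun lam x₀ g₀ ξ = ((lam ^ 2)⁻¹ : ℝ) • (modChar x₀ (lam⁻¹ • ξ) • g₀ (lam⁻¹ • ξ)) := rfl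

/-- `‖K(η)‖ = λ⁻² ‖g₀(η)‖`. [folklore] -/
theorem enorm_modKer (lam : ℝ) (x₀ : ℝ³) (g₀ : ℝ³ → ℂ³) (η : ℝ³) :
    ‖modKer lam x₀ g₀ η‖ₑ = ENNReal.ofReal ((lam ^ 2)⁻¹) * ‖g₀ η‖ₑ := by
  rw [modKer, enorm_smul, enorm_smul, Real.enorm_eq_ofReal (by positivity),
    ← ofReal_norm (modChar x₀ η), norm_modChar, ENNReal.ofReal_one, one_mul]

/-- `g'` is a.e.-strongly measurable for `‖ξ‖ dξ` when `g₀` is. [folklore] -/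
theorem aestronglyMeasurable_modFun {lam : ℝ} (hlam : 0 < lam) (x₀ : ℝ³) {g₀ : ℝ³ → ℂ³}
    (hg : AEStronglyMeasurable g₀ (FunctionSpaces.homSobolevMeasure ℝ³ (1 / 2 : ℝ))) :
    AEStronglyMeasurable (modFun lam x₀ g₀) (FunctionSpaces.homSobolevMeasure ℝ³ (1 / 2 : ℝ)) := by
  have h1 : AEStronglyMeasurable (fun η => modChar x₀ η • g₀ η)
      (FunctionSpaces.homSobolevMeasure ℝ³ (1 / 2 : ℝ)) :=
    AEStronglyMeasurable.smul (continuous_modChar x₀).aestronglyMeasurable hg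
  have hK : AEStronglyMeasurable (modKer lam x₀ g₀) (FunctionSpaces.homSobolevMeasure ℝ³ (1 / 2 : ℝ)) :=
    AEStronglyMeasurable.const_smul h1 ((lam ^ 2)⁻¹ : ℝ)
  exact hK.comp_quasiMeasurePreserving (quasiMeasurePreserving_smul (inv_ne_zero hlam.ne'))

/-- **Scale invariance of the `Ḣ^{1/2}(ℝ³)` norm on the Fourier side**:
`∫ ‖ξ‖ ‖g'(ξ)‖² dξ = ∫ ‖ξ‖ ‖g₀(ξ)‖² dξ` for `g'(ξ) = λ⁻² χ g₀(ξ/λ)`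
(`λ⁻⁴ · λ³ · λ = 1`; Rusin–Šverák 2011, §1 p. 3). [cite: RusinSverak2011, §1 (arXiv:0911.0500 p. 3)] -/
theorem lintegral_enorm_sq_modFun {lam : ℝ} (hlam : 0 < lam) (x₀ : ℝ³) (g₀ : ℝ³ → ℂ³) :
    ∫⁻ ξ, ‖modFun lam x₀ g₀ ξ‖ₑ ^ (2 : ℝ) ∂(FunctionSpaces.homSobolevMeasure ℝ³ (1 / 2 : ℝ)) =
      ∫⁻ ξ, ‖g₀ ξ‖ₑ ^ (2 : ℝ) ∂(FunctionSpaces.homSobolevMeasure ℝ³ (1 / 2 : ℝ)) := by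
  rw [homSobolevMeasure_half_eq,
    lintegral_withDensity_eq_lintegral_mul_non_measurable₀ _ (by fun_prop)
      (Eventually.of_forall fun ξ => enorm_lt_top),
    lintegral_withDensity_eq_lintegral_mul_non_measurable₀ _ (by fun_prop)
      (Eventually.of_forall fun ξ => enorm_lt_top)]
  simp only [Pi.mul_apply]
  set F : ℝ³ → ℝ≥0∞ := fun η => ‖lam • η‖ₑ * ‖modKer lam x₀ g₀ η‖ₑ ^ (2 : ℝ) with hF
  have h1 : (fun ξ : ℝ³ => ‖ξ‖ₑ * ‖modFun lam x₀ g₀ ξ‖ₑ ^ (2 : ℝ)) = fun ξ => F (lam⁻¹ • ξ) := by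
    funext ξ
    simp only [hF, modFun, smul_smul, mul_inv_cancel₀ hlam.ne', one_smul]
  rw [h1, lintegral_comp_smul F (inv_pos.2 hlam)]
  simp only [hF]
  have h2 : ∀ η : ℝ³, ‖lam • η‖ₑ * ‖modKer lam x₀ g₀ η‖ₑ ^ (2 : ℝ) =
      ENNReal.ofReal lam * ENNReal.ofReal ((lam ^ 2)⁻¹) ^ (2 : ℝ) *
        (‖η‖ₑ * ‖g₀ η‖ₑ ^ (2 : ℝ)) := by
    intro η
    rw [enorm_smul, Real.enorm_eq_ofReal hlam.le, enorm_modKer,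
      ENNReal.mul_rpow_of_nonneg _ _ (by norm_num)]
    ring
  simp_rw [h2]
  rw [lintegral_const_mul' _ _ (by simp [ENNReal.mul_eq_top]), ← mul_assoc]
  have h3 : ENNReal.ofReal ((lam⁻¹ ^ 3)⁻¹) *
      (ENNReal.ofReal lam * ENNReal.ofReal ((lam ^ 2)⁻¹) ^ (2 : ℝ)) = 1 := by
    rw [ENNReal.ofReal_rpow_of_nonneg (by positivity) (by norm_num), ← ENNReal.ofReal_mul
      (by positivity), ← ENNReal.ofReal_mul (by positivity), ← ENNReal.ofReal_one]
    congr 1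
    rw [Real.rpow_two]
    field_simp
  rw [h3, one_mul]

/-- `g'` is again a weighted-`L²` class. [folklore] -/
theorem memLp_modFun {lam : ℝ} (hlam : 0 < lam) (x₀ : ℝ³)
    (g : Lp ℂ³ 2 (FunctionSpaces.homSobolevMeasure ℝ³ (1 / 2 : ℝ))) :
    MemLp (modFun lam x₀ (g : ℝ³ → ℂ³)) 2 (FunctionSpaces.homSobolevMeasure ℝ³ (1 / 2 : ℝ)) := by
  refine ⟨aestronglyMeasurable_modFun hlam x₀ (Lp.aestronglyMeasurable g), ?_⟩
  rw [eLpNorm_eq_lintegral_rpow_enorm_toReal two_ne_zero ENNReal.ofNat_ne_top]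
  have := (Lp.memLp g).eLpNorm_lt_top
  rw [eLpNorm_eq_lintegral_rpow_enorm_toReal two_ne_zero ENNReal.ofNat_ne_top] at this
  simp only [ENNReal.toReal_ofNat] at this ⊢
  rwa [lintegral_enorm_sq_modFun hlam]

/-- `‖g'‖_{L²(‖ξ‖dξ)} = ‖g‖_{L²(‖ξ‖dξ)}` (Rusin–Šverák 2011, §1 p. 3: the `Ḣ^{1/2}` norm is
invariant under the symmetries). [cite: RusinSverak2011, §1 (arXiv:0911.0500 p. 3)] -/
theorem norm_toLp_modFun {lam : ℝ} (hlam : 0 < lam) (x₀ : ℝ³)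
    (g : Lp ℂ³ 2 (FunctionSpaces.homSobolevMeasure ℝ³ (1 / 2 : ℝ))) :
    ‖(memLp_modFun hlam x₀ g).toLp _‖ = ‖g‖ := by
  rw [Lp.norm_toLp, Lp.norm_def,
    eLpNorm_eq_lintegral_rpow_enorm_toReal two_ne_zero ENNReal.ofNat_ne_top,
    eLpNorm_eq_lintegral_rpow_enorm_toReal two_ne_zero ENNReal.ofNat_ne_top]
  simp only [ENNReal.toReal_ofNat]
  rw [lintegral_enorm_sq_modFun hlam]

/-- Dilation by `c ≠ 0` as a continuous linear automorphism of `ℝ³`. [folklore] -/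
def dilCLE {c : ℝ} (hc : c ≠ 0) : ℝ³ ≃L[ℝ] ℝ³ :=
  (LinearEquiv.smulOfNeZero ℝ ℝ³ c hc).toContinuousLinearEquiv

/-- Unfolding `dilCLE`. [folklore] -/
@[simp] theorem dilCLE_apply {c : ℝ} (hc : c ≠ 0) (y : ℝ³) : dilCLE hc y = c • y := rfl

/-- `Φ ↦ Φ ∘ A`, `A y = λ⁻¹ (y + x₀)`, on the Schwartz space (Mathlib `compSubConstCLM`,
`compCLMOfContinuousLinearEquiv`). [folklore] -/
def affComp {lam : ℝ} (hlam : 0 < lam) (x₀ : ℝ³) (Φ : 𝓢(ℝ³, ℂ)) : 𝓢(ℝ³, ℂ) :=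
  SchwartzMap.compSubConstCLM ℂ (-x₀)
    (SchwartzMap.compCLMOfContinuousLinearEquiv ℂ (dilCLE (inv_ne_zero hlam.ne')) Φ)

/-- Unfolding `affComp`. [folklore] -/
theorem affComp_apply {lam : ℝ} (hlam : 0 < lam) (x₀ : ℝ³) (Φ : 𝓢(ℝ³, ℂ)) (y : ℝ³) :
    affComp hlam x₀ Φ y = Φ (lam⁻¹ • (y + x₀)) := by
  simp [affComp, sub_neg_eq_add]

/-- The Schwartz function `ψ = 𝓕⁻¹((𝓕 φ) ∘ A)`, `A y = λ⁻¹(y + x₀)`, through which the pairing of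
the modulated datum with `𝓕 φ` is expressed. [folklore] -/
def psiFun {lam : ℝ} (hlam : 0 < lam) (x₀ : ℝ³) (φ : 𝓢(ℝ³, ℂ)) : 𝓢(ℝ³, ℂ) :=
  𝓕⁻ (affComp hlam x₀ (𝓕 φ))

/-- `𝓕 ψ (y) = 𝓕 φ (λ⁻¹ (y + x₀))` (Fourier inversion on `𝓢`). [folklore] -/
theorem fourier_psiFun_apply {lam : ℝ} (hlam : 0 < lam) (x₀ : ℝ³) (φ : 𝓢(ℝ³, ℂ)) (y : ℝ³) :
    𝓕 (psiFun hlam x₀ φ : ℝ³ → ℂ) y = 𝓕 (φ : ℝ³ → ℂ) (lam⁻¹ • (y + x₀)) := by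
  rw [psiFun, ← SchwartzMap.fourier_coe, fourier_fourierInv_eq, affComp_apply,
    SchwartzMap.fourier_coe]

/-- Explicit formula `ψ(w) = λ³ e^{-2πi⟨x₀, w⟩} φ(λ w)` (change of variables `v = λ y - x₀` in
the inverse Fourier integral, then inversion `𝓕⁻¹ 𝓕 φ = φ` on `𝓢`). [folklore] -/
theorem psiFun_apply {lam : ℝ} (hlam : 0 < lam) (x₀ : ℝ³) (φ : 𝓢(ℝ³, ℂ)) (w : ℝ³) :
    psiFun hlam x₀ φ w = ((lam ^ 3 : ℝ) : ℂ) * (modChar x₀ w * φ (lam • w)) := by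
  rw [psiFun, SchwartzMap.fourierInv_coe, Real.fourierInv_eq]
  simp_rw [affComp_apply]
  -- translate `v = u - x₀`
  have hT := integral_add_right_eq_self
    (μ := (volume : Measure ℝ³))
    (fun u : ℝ³ => 𝐞 ⟪u - x₀, w⟫ • (𝓕 φ : 𝓢(ℝ³, ℂ)) (lam⁻¹ • u)) x₀
  simp only [add_sub_cancel_right] at hT
  rw [hT]
  -- scale `u = lam • y`
  have hS := Measure.integral_comp_inv_smul_of_nonneg (volume : Measure ℝ³)
    (fun y : ℝ³ => 𝐞 ⟪lam • y - x₀, w⟫ • (𝓕 φ : 𝓢(ℝ³, ℂ)) y) hlam.le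
  simp only [smul_inv_smul₀ hlam.ne', finrank_euclideanSpace_fin] at hS
  rw [hS]
  -- character algebra `𝐞⟪λy - x₀, w⟫ = 𝐞(-⟪x₀, w⟫) 𝐞⟪y, λw⟫`
  have hC : ∀ y : ℝ³, 𝐞 ⟪lam • y - x₀, w⟫ • (𝓕 φ : 𝓢(ℝ³, ℂ)) y =
      modChar x₀ w * (𝐞 ⟪y, lam • w⟫ • (𝓕 φ : 𝓢(ℝ³, ℂ)) y) := by
    intro y
    rw [modChar_eq, inner_sub_left, real_inner_smul_left, ← real_inner_smul_right,
      sub_eq_add_neg, AddChar.map_add_eq_mul, Circle.smul_def, Circle.smul_def, Circle.coe_mul,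
      smul_eq_mul, smul_eq_mul]
    ring
  simp_rw [hC]
  rw [integral_const_mul, ← Real.fourierInv_eq, ← SchwartzMap.fourierInv_coe,
    fourierInv_fourier_eq, Complex.real_smul]

/-- Pointwise identity behind the first clause of `Represents`:
`𝓕φ(x) · λ f(λx - x₀) = λ (𝓕ψ · f)(λx - x₀)`. [folklore] -/
theorem integrand_one_eq {lam : ℝ} (hlam : 0 < lam) (x₀ : ℝ³) (φ : 𝓢(ℝ³, ℂ)) (f : ℝ³ → ℂ³)
    (x : ℝ³) :
    𝓕 (φ : ℝ³ → ℂ) x • ((lam : ℂ) • f (lam • x - x₀)) =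
      (lam : ℂ) • (fun y => 𝓕 (psiFun hlam x₀ φ : ℝ³ → ℂ) y • f y) (lam • x - x₀) := by
  simp only [fourier_psiFun_apply, sub_add_cancel, smul_smul, inv_smul_smul₀ hlam.ne']
  rw [mul_comm]

/-- Pointwise identity behind the second clause of `Represents`:
`φ(ξ) · g'(ξ) = λ⁻⁵ (ψ · g₀)(ξ/λ)`. [folklore] -/
theorem integrand_two_eq {lam : ℝ} (hlam : 0 < lam) (x₀ : ℝ³) (φ : 𝓢(ℝ³, ℂ)) (G : ℝ³ → ℂ³)
    (ξ : ℝ³) :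
    φ ξ • modFun lam x₀ G ξ =
      ((lam ^ 5)⁻¹ : ℂ) • (fun η => psiFun hlam x₀ φ η • G η) (lam⁻¹ • ξ) := by
  simp only [modFun, modKer, psiFun_apply, smul_inv_smul₀ hlam.ne', smul_smul,
    ← Complex.coe_smul]
  congr 1
  push_cast
  field_simp

end HomSobolevSymmetry

open HomSobolevSymmetry in
/-- **Transfer of `HomSobolev.Represents` under the symmetries of data.** If `g ∈ Ḣ^{1/2}(ℝ³; ℂ³)`
represents `f`, then the class of `g'(ξ) = λ⁻² e^{-2πi⟨x₀,ξ⟩/λ} g(ξ/λ)` represents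
`x ↦ λ f(λ x - x₀)` and has the same norm (Rusin–Šverák 2011, §1 p. 3; all three clauses of
`Represents` are pulled back to those of `(f, g)` through `ψ = λ³ e^{-2πi⟨x₀,·⟩} φ(λ ·) ∈ 𝓢`).
Deliberate dot-notation extension of `Literature.Analysis.FunctionSpaces.HomSobolev.Represents`.
[cite: RusinSverak2011, §1 (arXiv:0911.0500 p. 3)] -/
theorem _root_.Literature.Analysis.FunctionSpaces.HomSobolev.Represents.exists_rescale_translate
    {g : FunctionSpaces.HomSobolev ℝ³ ℂ³ (1 / 2 : ℝ)} {f : ℝ³ → ℂ³} (hg : g.Represents f) {lam : ℝ}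
    (hlam : 0 < lam) (x₀ : ℝ³) :
    ∃ g' : FunctionSpaces.HomSobolev ℝ³ ℂ³ (1 / 2 : ℝ),
      g'.Represents ((lam : ℂ) • fun x => f (lam • x - x₀)) ∧ ‖g'‖ = ‖g‖ := by
  obtain ⟨h1, h2, h3⟩ := hg
  set G : ℝ³ → ℂ³ := ((FunctionSpaces.HomSobolev.toLp (1 / 2 : ℝ) g : Lp ℂ³ 2 (FunctionSpaces.homSobolevMeasure ℝ³ _)) :
    ℝ³ → ℂ³) with hG
  have hmem := memLp_modFun hlam x₀ (FunctionSpaces.HomSobolev.toLp (1 / 2 : ℝ) g)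
  set g' : FunctionSpaces.HomSobolev ℝ³ ℂ³ (1 / 2 : ℝ) := (FunctionSpaces.HomSobolev.toLp (1 / 2 : ℝ)).symm (hmem.toLp _)
    with hg'
  have hcoe : ((FunctionSpaces.HomSobolev.toLp (1 / 2 : ℝ) g' : Lp ℂ³ 2 (FunctionSpaces.homSobolevMeasure ℝ³ _)) : ℝ³ → ℂ³)
      =ᵐ[volume] modFun lam x₀ G := by
    have : ((FunctionSpaces.HomSobolev.toLp (1 / 2 : ℝ) g' : Lp ℂ³ 2 (FunctionSpaces.homSobolevMeasure ℝ³ _)) : ℝ³ → ℂ³)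
        =ᵐ[FunctionSpaces.homSobolevMeasure ℝ³ (1 / 2 : ℝ)] modFun lam x₀ G := by
      rw [hg', LinearIsometryEquiv.apply_symm_apply]
      exact hmem.coeFn_toLp
    exact volume_absolutelyContinuous_homSobolevMeasure_half.ae_eq this
  refine ⟨g', ⟨fun φ => ?_, fun φ => ?_, fun φ => ?_⟩, ?_⟩
  · -- clause 1: integrability of `𝓕φ • f'`
    have hH := h1 (psiFun hlam x₀ φ)
    have : (fun x : ℝ³ => 𝓕 (φ : ℝ³ → ℂ) x • ((lam : ℂ) • fun x => f (lam • x - x₀)) x) =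
        fun x => (lam : ℂ) • (fun y => 𝓕 (psiFun hlam x₀ φ : ℝ³ → ℂ) y • f y) (lam • x - x₀) := by
      funext x
      exact integrand_one_eq hlam x₀ φ f x
    rw [SchwartzMap.fourier_coe, this]
    exact ((hH.comp_sub_right x₀).comp_smul hlam.ne').smul (lam : ℂ)
  · -- clause 2: integrability of `φ • g'`
    have hJ := h2 (psiFun hlam x₀ φ)
    have hint : Integrable (fun ξ : ℝ³ => φ ξ • modFun lam x₀ G ξ) := by
      have : (fun ξ : ℝ³ => φ ξ • modFun lam x₀ G ξ) =
          fun ξ => ((lam ^ 5)⁻¹ : ℂ) • (fun η => psiFun hlam x₀ φ η • G η) (lam⁻¹ • ξ) := by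
        funext ξ
        exact integrand_two_eq hlam x₀ φ G ξ
      rw [this]
      exact (hJ.comp_smul (inv_ne_zero hlam.ne')).smul ((lam ^ 5)⁻¹ : ℂ)
    exact hint.congr (hcoe.mono fun ξ hξ => by simp only [hξ])
  · -- clause 3: the pairing identity
    have hI := h3 (psiFun hlam x₀ φ)
    rw [SchwartzMap.fourier_coe] at hI
    have hL : ∫ x, 𝓕 (φ : ℝ³ → ℂ) x • ((lam : ℂ) • fun x => f (lam • x - x₀)) x =
        (lam : ℂ) • (((lam ^ 3)⁻¹ : ℝ) • ∫ y, 𝓕 (psiFun hlam x₀ φ : ℝ³ → ℂ) y • f y) := by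
      have : (fun x : ℝ³ => 𝓕 (φ : ℝ³ → ℂ) x • ((lam : ℂ) • fun x => f (lam • x - x₀)) x) =
          fun x => (lam : ℂ) • (fun y => 𝓕 (psiFun hlam x₀ φ : ℝ³ → ℂ) y • f y)
            (lam • x - x₀) := by
        funext x
        exact integrand_one_eq hlam x₀ φ f x
      rw [this, integral_smul]
      congr 1
      have hs := Measure.integral_comp_smul_of_nonneg volume
        (fun z : ℝ³ => (fun y => 𝓕 (psiFun hlam x₀ φ : ℝ³ → ℂ) y • f y) (z - x₀)) lam
        (hR := hlam.le)
      simp only [finrank_euclideanSpace_fin] at hs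
      rw [hs]
      congr 1
      exact integral_sub_right_eq_self (fun y => 𝓕 (psiFun hlam x₀ φ : ℝ³ → ℂ) y • f y) x₀
    have hR : ∫ ξ, φ ξ • ((FunctionSpaces.HomSobolev.toLp (1 / 2 : ℝ) g' :
        Lp ℂ³ 2 (FunctionSpaces.homSobolevMeasure ℝ³ _)) : ℝ³ → ℂ³) ξ =
        ((lam ^ 5)⁻¹ : ℂ) • ((lam ^ 3 : ℝ) • ∫ η, psiFun hlam x₀ φ η • G η) := by
      rw [integral_congr_ae (hcoe.mono fun ξ hξ => by simp only [hξ] : (fun ξ => φ ξ •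
        ((FunctionSpaces.HomSobolev.toLp (1 / 2 : ℝ) g' : Lp ℂ³ 2 (FunctionSpaces.homSobolevMeasure ℝ³ _)) : ℝ³ → ℂ³) ξ)
          =ᵐ[volume] fun ξ => φ ξ • modFun lam x₀ G ξ)]
      have : (fun ξ : ℝ³ => φ ξ • modFun lam x₀ G ξ) =
          fun ξ => ((lam ^ 5)⁻¹ : ℂ) • (fun η => psiFun hlam x₀ φ η • G η) (lam⁻¹ • ξ) := by
        funext ξ
        exact integrand_two_eq hlam x₀ φ G ξ
      rw [this, integral_smul]
      congr 1
      have hs := Measure.integral_comp_inv_smul_of_nonneg volume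
        (fun η => psiFun hlam x₀ φ η • G η) hlam.le
      simpa only [finrank_euclideanSpace_fin] using hs
    rw [SchwartzMap.fourier_coe, hL, hR, hI, ← Complex.coe_smul, ← Complex.coe_smul, smul_smul,
      smul_smul]
    congr 1
    push_cast
    field_simp
  · -- the norm
    rw [FunctionSpaces.HomSobolev.norm_def, FunctionSpaces.HomSobolev.norm_def, hg', LinearIsometryEquiv.apply_symm_apply]
    exact norm_toLp_modFun hlam x₀ _

section NS

/-- **Invariance of `Ḣ^{1/2}` data under the Navier–Stokes symmetries** (Rusin–Šverák,
arXiv:0911.0500, §1, p. 3: "The `Ḣ^{1/2}`-norm is invariant under the natural scaling of the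
initial data `u₀(x) → λ u₀(λx)`", and the translations `u₀(x) → u₀(x - x₀)` of the same
paragraph), for the representation predicate `HomSobolev.Represents` of `MildSolutions.lean`:
if `g ∈ Ḣ^{1/2}(ℝ³; ℂ³)` represents `complexify ∘ u₀`, then for `λ > 0`, `x₀ ∈ ℝ³` some
`g' ∈ Ḣ^{1/2}` with `‖g'‖ = ‖g‖` represents the modulated datum
`complexify ∘ (x ↦ λ u₀(λ x - x₀))` = `complexify ∘ NS.rescaleData λ (u₀ (· - x₀))`; explicitly
`g'(ξ) = λ⁻² e^{-2πi⟨x₀, ξ⟩/λ} g(ξ/λ)` (`HomSobolev.Represents.exists_rescale_translate`).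
[cite: RusinSverak2011, §1 (arXiv:0911.0500 p. 3)] -/
theorem exists_represents_rescaleData_norm_eq (u₀ : ℝ³ → ℝ³)
    (g : FunctionSpaces.HomSobolev ℝ³ ℂ³ (1 / 2 : ℝ)) {lam : ℝ} (hlam : 0 < lam) (x₀ : ℝ³)
    (hg : g.Represents (FunctionSpaces.EuclideanSpace.complexify ∘ u₀)) :
    ∃ g' : FunctionSpaces.HomSobolev ℝ³ ℂ³ (1 / 2 : ℝ),
      g'.Represents (FunctionSpaces.EuclideanSpace.complexify ∘ FluidPDE.rescaleData lam (fun x => u₀ (x - x₀))) ∧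
        ‖g'‖ = ‖g‖ := by
  rw [complexify_comp_rescaleData]
  exact hg.exists_rescale_translate hlam x₀

/-! ## The PDE input from the paper -/

/-- NAMED FACT (Rusin–Šverák, arXiv:0911.0500 = J. Funct. Anal. 260 (2011): the PDE content of
the proof of Cor. 4.3, p. 8, i.e. its sentences 2–4, which combine the normalisation of the
first singularity (§3 p. 5, §4 p. 6, Prop. 4.1 p. 7) with the stability of singularities under
weak convergence of the data, Cor. 4.2 p. 8 (from Thm. 4.2, Lemma 4.1, Prop. 2.2, Lemma 2.1,
Thm. 4.1)). In print (p. 8): "Let `u₀^k ∈ Ḣ^{1/2}` be a sequence of initial data with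
`T_max(u₀^k)` finite [...]. Find `λ_k > 0` and `x₀^k` so that the functions given by
`v^k(x) = λ_k u₀^k(λ_k x - x₀^k)` develop their first singularity at time `t = 1` and that
`(x,t) = (0,1)` is a singular point of `v^k`. We can assume that the functions `v₀^k` converge
weakly in `Ḣ^{1/2}` to `v₀ ∈ Ḣ^{1/2}`. By Corollary 4.2 we know that `T_max(v₀) ≤ 1`."
Transcription (conventions of `rusin_sverak_minimal_blowup`: a datum is an `L³`, weakly
divergence-free field represented by a class in `Ḣ^{1/2}`; "`T_max < ∞`" is
`¬ HasGlobalKatoSolution ν`; general `ν > 0` from `ν = 1` by the scaling `u ↦ ν u(·, ν ·)`):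
for `ν > 0` and a sequence of blow-up data `(u₀^k, g_k)` bounded in `Ḣ^{1/2}`, there are
`λ_k > 0`, `x₀^k ∈ ℝ³` such that for any classes `g'_k ∈ Ḣ^{1/2}` representing the modulated
data `x ↦ λ_k u₀^k(λ_k x - x₀^k)` (the representing class is unique, being determined by its
pairings with `𝓢`; it exists by `exists_represents_rescaleData_norm_eq`), every weak
`Ḣ^{1/2}`-limit `g_∞` of a subsequence `(g'_{φ(n)})` (`⟪g'_{φ(n)}, w⟫ → ⟪g_∞, w⟫` for all `w`)
represents a blow-up datum: an `L³`, weakly divergence-free `v₀` with no global Kato solution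
(`T_max(v₀) ≤ 1 < ∞`; that the weak limit is again a datum is `Ḣ^{1/2} ⊂ L³`,
Bahouri–Chemin–Danchin 2011 Thm. 1.38, with reality and the divergence constraint preserved
under weak limits). The minimality `‖u₀^k‖ = ρ_max` of Cor. 4.3 is not used in these sentences
and is not assumed. Grounds step 3 of `rusin_sverak_minimal_data_compact_of_weak_limit_blowup`;
to be refined into Cor. 4.2 proper once `T_max` and Rusin–Šverák's Leray solutions `NS(u₀)`
(§4 p. 6) are Literature notions. Users take `(h : rusin_sverak_weak_limit_blowup)`.
[cite: RusinSverak2011, proof of Cor. 4.3 with Cor. 4.2 and Prop. 4.1 (arXiv:0911.0500 pp. 7–8)] -/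
def rusin_sverak_weak_limit_blowup : Prop :=
  ∀ (ν : ℝ) (_hν : 0 < ν) (u₀ : ℕ → ℝ³ → ℝ³) (g : ℕ → FunctionSpaces.HomSobolev ℝ³ ℂ³ (1 / 2 : ℝ)),
    (∀ k, MemLp (u₀ k) 3 ∧ (g k).Represents (FunctionSpaces.EuclideanSpace.complexify ∘ u₀ k) ∧
      FluidPDE.IsWeaklyDivFree (u₀ k) ∧ ¬ HasGlobalKatoSolution ν (u₀ k)) →
    (∃ R : ℝ, ∀ k, ‖g k‖ ≤ R) →
    ∃ (lam : ℕ → ℝ) (x₀ : ℕ → ℝ³), (∀ k, 0 < lam k) ∧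
      ∀ g' : ℕ → FunctionSpaces.HomSobolev ℝ³ ℂ³ (1 / 2 : ℝ),
        (∀ k, (g' k).Represents
          (FunctionSpaces.EuclideanSpace.complexify ∘ FluidPDE.rescaleData (lam k) (fun x => u₀ k (x - x₀ k)))) →
        ∀ φ : ℕ → ℕ, StrictMono φ → ∀ glim : FunctionSpaces.HomSobolev ℝ³ ℂ³ (1 / 2 : ℝ),
          (∀ w, Tendsto (fun n => ⟪g' (φ n), w⟫_ℂ) atTop (𝓝 ⟪glim, w⟫_ℂ)) →
          ∃ v₀ : ℝ³ → ℝ³, MemLp v₀ 3 ∧ glim.Represents (FunctionSpaces.EuclideanSpace.complexify ∘ v₀) ∧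
            FluidPDE.IsWeaklyDivFree v₀ ∧ ¬ HasGlobalKatoSolution ν v₀

/-! ## Assembly: steps 2, 4, 5 of the printed proof -/

/-- **Rusin–Šverák, Cor. 4.3 (second clause), from its PDE input.** Given the blow-up of weak
limits of normalised blow-up data (`rusin_sverak_weak_limit_blowup`), the set of
`Ḣ^{1/2}`-minimal blow-up data is compact modulo scalings and translations
(`rusin_sverak_minimal_data_compact`). Proof = steps 2, 4, 5 of the printed proof
(arXiv:0911.0500 p. 8): the modulated classes (`exists_represents_rescaleData_norm_eq`) have
norm `ρ_max`; every subsequence has a weakly convergent subsequence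
(`exists_strictMono_tendsto_inner`); its limit is a blow-up datum, so by the definition of
`ρ_max^pure` (`hasGlobalKatoSolution_of_lt_rusinSverakRhoMaxPure`) its norm is `≥ ρ_max`, and
`≤ ρ_max` as a weak limit; Radon–Riesz (`tendsto_of_tendsto_inner_of_norm_eq`) upgrades to
strong convergence, and `isCompact_closure_range_of_subseq` concludes.
[cite: RusinSverak2011, Cor. 4.3 (arXiv:0911.0500 p. 8)] -/
theorem rusin_sverak_minimal_data_compact_of_weak_limit_blowup
    (hKS : rusin_sverak_weak_limit_blowup) : rusin_sverak_minimal_data_compact := by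
  intro ν hν _hfin u₀ g hM
  have hdata : ∀ k, MemLp (u₀ k) 3 ∧ (g k).Represents (FunctionSpaces.EuclideanSpace.complexify ∘ u₀ k) ∧
      FluidPDE.IsWeaklyDivFree (u₀ k) ∧ ¬ HasGlobalKatoSolution ν (u₀ k) := fun k =>
    ⟨(hM k).1, (hM k).2.1, (hM k).2.2.1, (hM k).2.2.2.2⟩
  set ρ := rusinSverakRhoMaxPure ν with hρ
  have hnorm : ∀ k, ‖g k‖ = ρ.toReal := fun k => by
    have hk : ‖g k‖ₑ = ρ := (hM k).2.2.2.1
    rw [← hk, toReal_enorm]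
  obtain ⟨lam, x₀, hlam, hlim⟩ := hKS ν hν u₀ g hdata ⟨ρ.toReal, fun k => (hnorm k).le⟩
  choose g' hg'rep hg'norm using
    fun k => exists_represents_rescaleData_norm_eq (u₀ k) (g k) (hlam k) (x₀ k) (hM k).2.1
  refine ⟨lam, x₀, g', hlam, hg'rep, ?_⟩
  haveI : SecondCountableTopology (FunctionSpaces.HomSobolev ℝ³ ℂ³ (1 / 2 : ℝ)) :=
    homSobolev_half_secondCountableTopology
  apply isCompact_closure_range_of_subseq
  intro σ hσ
  -- step 2: a bounded subsequence has a weakly convergent subsequence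
  have hb : ∀ n, ‖g' (σ n)‖ ≤ ρ.toReal := fun n => by rw [hg'norm, hnorm]
  obtain ⟨glim, φ, hφ, hle, hweak⟩ := exists_strictMono_tendsto_inner (fun n => g' (σ n)) hb
  -- step 3 (the fact): the weak limit is a blow-up datum
  obtain ⟨v₀, hv3, hvrep, hvdiv, hvblow⟩ :=
    hlim g' hg'rep (σ ∘ φ) (hσ.comp hφ) glim hweak
  -- step 4: hence it has norm `≥ ρ_max` ...
  have hge : ρ ≤ ‖glim‖ₑ := by
    by_contra hlt
    push Not at hlt
    exact hvblow (hasGlobalKatoSolution_of_lt_rusinSverakRhoMaxPure hv3 hvrep hvdiv hlt)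
  -- ... and `≤ ρ_max` as a weak limit of a sequence on the sphere of radius `ρ_max`
  have hnormlim : ‖glim‖ = ρ.toReal := by
    refine le_antisymm hle ?_
    have := ENNReal.toReal_mono (enorm_ne_top (x := glim)) hge
    rwa [toReal_enorm] at this
  -- step 5: Radon–Riesz
  refine ⟨glim, φ, hφ, ?_⟩
  exact tendsto_of_tendsto_inner_of_norm_eq hweak
    (fun n => by rw [hnormlim, hg'norm, hnorm])

end NS

end Literature.Analysis.FluidPDE
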